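import Mathlib.LinearAlgebra.Vandermonde
import Mathlib.LinearAlgebra.Matrix.AbsoluteValue
import Mathlib.RingTheory.Polynomial.Chebyshev
import Mathlib.Analysis.SpecialFunctions.Trigonometric.Chebyshev.RootsExtrema
import Mathlib.Analysis.SpecificLimits.Normed
import Mathlib.Analysis.SpecialFunctions.Pow.Real
import Mathlib.MeasureTheory.Integral.Pi
import Mathlib.NumberTheory.Real.Irrational
import Literature.Barriers.AtomisticToContinuum.OneDimensionalHardCoreProofs

/-!
# Zudilin's determinantal irrationality criterion (2017)

Topic `Literature/NumberTheory/Irrationality`. HONEST FRAMING (cell pub-zeta5): systematic search; no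
irrationality claim unless certified — this file PROVES a published criterion, it certifies nothing new.

W. Zudilin, *A determinantal approach to irrationality*, Constr. Approx. **45** (2017) 301–310
[Zudilin2017Det]. Setting (§1): a real number `ξ` and a sequence of rational approximations
`r_n = a_n ξ − b_n`, `n = 0, 1, 2, …`, subject to

* (a) `0 < r_n ≤ C₁ εⁿ`;
* (b) `δ_n a_n, δ_n b_n ∈ ℤ` for positive integers `δ_n`;
* (c) `δ_n < C₂ Δⁿ`;
* (d) `r_n = ∫_γ z(𝛄)ⁿ ω(𝛄)` for a domain `γ ⊂ ℝ^m`, a non-constant continuous `z ≥ 0` on `γ` and a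
  positive measure `ω`;
* (e) `δ_n ∣ δ_{n+1}`.

**Proposition 1** (classical): under (a)–(c), `εΔ < 1 ⇒ ξ ∉ ℚ`. **Proposition 2** [Zudilin2017Det, Prop. 2]:
under (a)–(e), `ε Δ^{3/2} / 4 < 1 ⇒ ξ ∉ ℚ`.

## What is proved here (the printed proof of §2, step by step)

* `hankel r n` — the Hankel matrix `(r_{j+ℓ})_{0 ≤ j,ℓ < n}`; its determinant is the `R_n` of the source,
  display (4).
* (A) `exists_int_eq_scaled_hankel_det` — arithmetic: with `ξ = p/q`, hypotheses (b), (e) give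
  `(∏_{j<n} δ_{n-1+j} q) · R_n ∈ ℤ` (source: "`δ_{n−1} δ_n ⋯ δ_{2n−2} R_n ∈ ℤξⁿ + ⋯ + ℤ`").
* (B) `factorial_mul_hankel_det_eq_integral` — **Heine's identity** `n! R_n = ∫_{γⁿ} ∏_{j<ℓ} (z(𝛄_ℓ) − z(𝛄_j))² ωⁿ`
  (source display (3)/(4)), obtained from the tree's general Andréief identity
  `Literature.Barriers.AtomisticToContinuum.BoseGas.integral_det_mul_det` and `Matrix.det_vandermonde`.
* (C) `abs_det_vandermonde_le` — the Fekete–Chebyshev input in effective form: for `u ∈ [0, ε]ⁿ`,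
  `|V(u)| ≤ n! 2ⁿ (ε/4)^{n(n−1)/2}` (monic rescaled Chebyshev polynomials have sup `2(ε/4)^k` on `[0,ε]`;
  Leibniz bound `Matrix.det_le`). The source uses the sharp limit `(ε/4)^{n²(1+o(1))}` (Fekete–Chebyshev
  constant of `[0, ε]`); the cruder constant is irrelevant for the criterion.
* (D) `hankel_det_nonneg`, `hankel_det_le` — `0 ≤ R_n ≤ n! 4ⁿ (ε/4)^{n(n−1)} ω(γ)ⁿ`.
* (E) `irrational_of_hankel` — the criterion. DEVIATION (stated honestly): the source's standing hypothesis
  (d) makes `R_n > 0` automatic ("Note that `R_n > 0`, because the integrand is nonnegative" — strictness uses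
  that `z` is continuous and non-constant on a domain); here the measure space is arbitrary (finite measure,
  `0 ≤ z ≤ ε` pointwise), so non-vanishing of `R_n` for infinitely many `n` is an explicit hypothesis (d′), and
  hypothesis (a) is then not needed at all (it enters the printed proof only through `max z ≤ ε`). With (d′) the
  theorem is exactly the printed argument: integer `≥ 1` versus
  `(4 C₂ q ω(γ))ⁿ · n! · (εΔ^{3/2}/4)^{n(n−1)} → 0`.

* (F) `hankel_det_pos`, `irrational_of_hankel_of_continuous` — the printed hypothesis (d) recovered in
  topological form: `μ` finite and positive on non-empty open sets, `z` continuous with infinitely many values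
  (non-constant on a preconnected space suffices: `irrational_of_hankel_of_preconnected`) ⇒ `R_n > 0` for all `n`,
  so (d′) holds and Proposition 2 follows with (d) as printed (for `γ` a domain with a positive continuous
  density, take `α = γ`).

No new named facts (D-0026): everything is a theorem.
-/

open Finset MeasureTheory Filter Topology Polynomial

namespace Literature.NumberTheory.Irrationality.Zudilin2017

/-! ### The Hankel determinants `R_n` -/

/-- The `n × n` Hankel matrix `(r_{j+ℓ})_{0 ≤ j, ℓ < n}` of a sequence `r`; `(hankel r n).det` is the
`R_n = det_{0≤j,ℓ<n}(r_{j+ℓ})` of the source. [cite: Zudilin2017Det, §2 display (4)] -/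
def hankel (r : ℕ → ℝ) (n : ℕ) : Matrix (Fin n) (Fin n) ℝ :=
  Matrix.of fun j ℓ => r (j + ℓ)

/-- Unfolding lemma (plumbing). [folklore] -/
@[simp] private theorem hankel_apply (r : ℕ → ℝ) (n : ℕ) (j ℓ : Fin n) :
    hankel r n j ℓ = r (j + ℓ) := rfl

/-! ### (A) Arithmetic: hypotheses (b) and (e) -/

/-- The chain condition (e) `δ_m ∣ δ_{m+1}` gives `δ_i ∣ δ_j` for `i ≤ j` (private helper). [folklore] -/
private theorem dvd_of_chain {δ : ℕ → ℕ} (h : ∀ m, δ m ∣ δ (m + 1)) {i j : ℕ} (hij : i ≤ j) : δ i ∣ δ j := by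
  induction hij with
  | refl => exact dvd_rfl
  | step _ ih => exact ih.trans (h _)

/-- (A) If `r_m = a_m ξ − b_m` with `δ_m a_m, δ_m b_m ∈ ℤ` (b), `δ_m ∣ δ_{m+1}` (e) and `ξ = p/q`, then
`(∏_{j<n} δ_{n−1+j} q) · det (r_{j+ℓ}) ∈ ℤ` — row `j` of the Hankel matrix is cleared by `δ_{n−1+j} q`.
[cite: Zudilin2017Det, §2, "`δ_{n−1}δ_n⋯δ_{2n−2} R_n ∈ ℤξⁿ + ⋯ + ℤξ + ℤ`"] -/
theorem exists_int_eq_scaled_hankel_det (r a b : ℕ → ℝ) (ξ : ℝ) (hr : ∀ m, r m = a m * ξ - b m)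
    (δ : ℕ → ℕ) (hδ : ∀ m, 0 < δ m) (hchain : ∀ m, δ m ∣ δ (m + 1))
    (A B : ℕ → ℤ) (ha : ∀ m, (δ m : ℝ) * a m = A m) (hb : ∀ m, (δ m : ℝ) * b m = B m)
    (p : ℤ) (q : ℕ) (hq : 0 < q) (hξ : ξ = p / q) (n : ℕ) :
    ∃ K : ℤ, (∏ j : Fin n, ((δ (n - 1 + j) : ℝ) * q)) * (hankel r n).det = K := by
  have hqne : (q : ℝ) ≠ 0 := by positivity
  have key : ∀ j ℓ : Fin n, ∃ k : ℤ, (δ (n - 1 + j) : ℝ) * q * r (j + ℓ) = k := by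
    intro j ℓ
    have hle : (j : ℕ) + ℓ ≤ n - 1 + j := by omega
    obtain ⟨c, hc⟩ := dvd_of_chain hchain hle
    refine ⟨c * (A (j + ℓ) * p - B (j + ℓ) * q), ?_⟩
    have hδne : (δ (j + ℓ) : ℝ) ≠ 0 := by exact_mod_cast (hδ _).ne'
    rw [hr, hξ, hc]
    push_cast
    rw [← ha, ← hb]
    field_simp
  choose k hk using key
  refine ⟨(Matrix.of fun j ℓ => k j ℓ).det, ?_⟩
  rw [← Matrix.det_mul_column]
  rw [Int.cast_det]
  congr 1
  ext j ℓ
  simp [Matrix.map_apply, hk]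

/-! ### (B) Heine's identity via Andréief -/

section Heine

variable {α : Type*} [MeasurableSpace α]

/-- Integrability of the products of powers of a bounded a.e.-strongly measurable `z` (finite measure;
private helper). [folklore] -/
private theorem integrable_pow_mul_pow (μ : Measure α) [IsFiniteMeasure μ] (z : α → ℝ)
    (hz : AEStronglyMeasurable z μ) {ε : ℝ} (hzb : ∀ x, |z x| ≤ ε) (s t : ℕ) :
    Integrable (fun x => z x ^ s * z x ^ t) μ := by
  refine Integrable.mono' (integrable_const (ε ^ s * ε ^ t)) ((hz.pow s).mul (hz.pow t))
    (Eventually.of_forall fun x => ?_)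
  have h0 : 0 ≤ |z x| := abs_nonneg _
  rw [Real.norm_eq_abs, abs_mul, abs_pow, abs_pow]
  exact mul_le_mul (pow_le_pow_left₀ h0 (hzb x) s) (pow_le_pow_left₀ h0 (hzb x) t) (by positivity)
    (by have := le_trans h0 (hzb x); positivity)

/-- (B) **Heine's identity** for the Hankel determinants of a moment sequence `r_m = ∫ zᵐ dμ`:
`n! · det (r_{j+ℓ})_{j,ℓ<n} = ∫_{αⁿ} ∏_{i<j} (z(x_j) − z(x_i))² dμ^{⊗n}`.
[cite: Zudilin2017Det, §2 displays (3)–(4) and "Proof of identity (4)" (Heine [He78])]; obtained from the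
general Andréief identity already in the tree. -/
theorem factorial_mul_hankel_det_eq_integral (μ : Measure α) [IsFiniteMeasure μ] (z : α → ℝ)
    (hz : AEStronglyMeasurable z μ) {ε : ℝ} (hzb : ∀ x, |z x| ≤ ε)
    (r : ℕ → ℝ) (hr : ∀ m, r m = ∫ x, z x ^ m ∂μ) (n : ℕ) :
    ((Nat.factorial n : ℕ) : ℝ) * (hankel r n).det =
      ∫ X : Fin n → α, (∏ i : Fin n, ∏ j ∈ Ioi i, (z (X j) - z (X i))) ^ 2
        ∂(Measure.pi fun _ => μ) := by
  have hint : ∀ t t' : Fin n, Integrable (fun x => z x ^ (t : ℕ) * z x ^ (t' : ℕ)) μ :=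
    fun t t' => integrable_pow_mul_pow μ z hz hzb t t'
  have h := Literature.Barriers.AtomisticToContinuum.BoseGas.integral_det_mul_det (𝕜 := ℝ) μ
    (fun (t : Fin n) x => z x ^ (t : ℕ)) (fun (t : Fin n) x => z x ^ (t : ℕ)) hint
  have hV : ∀ X : Fin n → α,
      (Matrix.of fun (r : Fin n) (t : Fin n) => z (X r) ^ (t : ℕ)).det
        = ∏ i : Fin n, ∏ j ∈ Ioi i, (z (X j) - z (X i)) :=
    fun X => Matrix.det_vandermonde (fun r => z (X r))
  have hH : (Matrix.of fun t t' : Fin n => ∫ x, z x ^ (t : ℕ) * z x ^ (t' : ℕ) ∂μ) = hankel r n := by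
    ext t t'
    simp only [Matrix.of_apply, hankel_apply, hr, pow_add]
  rw [hH] at h
  simp_rw [hV] at h
  rw [← h]
  congr 1
  ext X
  ring

end Heine

/-! ### (C) The Fekete–Chebyshev bound for Vandermonde determinants on `[0, ε]ⁿ` -/

/-- (C) For `u ∈ [0, ε]ⁿ` (`ε > 0`): `|det V(u)| = ∏_{i<j} |u_j − u_i| ≤ n! · 2ⁿ · (ε/4)^{n(n−1)/2}`.
Proof: the Vandermonde determinant equals `det (p_k(u_i))` for the monic polynomials
`p_k = (ε/2)^k 2^{1−k} T_k(2x/ε − 1)` (Chebyshev), whose sup on `[0, ε]` is `≤ 2 (ε/4)^k`; then the Leibniz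
bound. [cite: Zudilin2017Det, §2 display (5) (Fekete–Chebyshev constant `ε/4` of `[0, ε]`); effective
variant proved here] -/
theorem abs_det_vandermonde_le {n : ℕ} {ε : ℝ} (hε : 0 < ε) (u : Fin n → ℝ)
    (hu : ∀ i, u i ∈ Set.Icc 0 ε) :
    |(Matrix.vandermonde u).det| ≤ (Nat.factorial n : ℝ) * 2 ^ n * (ε / 4) ^ (n * (n - 1) / 2) := by
  have hε0 : ε ≠ 0 := hε.ne'
  -- the affine substitution `x ↦ 2x/ε − 1`
  set L : ℝ[X] := C (2 / ε) * X - C 1 with hL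
  have hLdeg : L.natDegree = 1 := by
    rw [hL, natDegree_sub_C, natDegree_C_mul_X _ (by positivity)]
  have hLlc : L.leadingCoeff = 2 / ε := by
    rw [hL, leadingCoeff_sub_of_degree_lt, leadingCoeff_C_mul_X]
    rw [degree_C one_ne_zero, degree_C_mul_X (by positivity)]
    exact zero_lt_one
  -- the monic rescaled Chebyshev polynomials
  set p : Fin n → ℝ[X] :=
    fun k => C ((ε / 2) ^ (k : ℕ) / 2 ^ ((k : ℕ) - 1)) * (Chebyshev.T ℝ k).comp L with hp
  have hTdeg : ∀ k : ℕ, (Chebyshev.T ℝ k).natDegree = k := by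
    intro k; rw [Chebyshev.natDegree_T]; simp
  have hTlc : ∀ k : ℕ, (Chebyshev.T ℝ k).leadingCoeff = 2 ^ (k - 1) := by
    intro k; rw [Chebyshev.leadingCoeff_T]; simp
  have hcoef : ∀ k : ℕ, (ε / 2) ^ k / 2 ^ (k - 1) ≠ (0 : ℝ) := fun k => by positivity
  have hcompdeg : ∀ k : ℕ, ((Chebyshev.T ℝ k).comp L).natDegree = k := by
    intro k; rw [natDegree_comp, hTdeg, hLdeg, mul_one]
  have hcomplc : ∀ k : ℕ, ((Chebyshev.T ℝ k).comp L).leadingCoeff = 2 ^ (k - 1) * (2 / ε) ^ k := by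
    intro k; rw [leadingCoeff_comp (by rw [hLdeg]; exact one_ne_zero), hTlc, hLlc, hTdeg]
  have hdeg : ∀ k : Fin n, (p k).natDegree = k := by
    intro k
    rw [hp]
    dsimp only
    rw [natDegree_C_mul (hcoef k), hcompdeg]
  have hmonic : ∀ k : Fin n, (p k).Monic := by
    intro k
    rw [Monic, hp]
    dsimp only
    rw [leadingCoeff_C_mul_of_isUnit (hcoef k).isUnit, hcomplc]
    have h2 : (2 : ℝ) ^ ((k : ℕ) - 1) ≠ 0 := by positivity
    have h1 : ε / 2 * (2 / ε) = (1 : ℝ) := by field_simp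
    rw [← mul_assoc, div_mul_cancel₀ _ h2, ← mul_pow, h1, one_pow]
  -- sup bounds on `[0, ε]`
  have hnum : ∀ k : ℕ, (ε / 2) ^ k / 2 ^ (k - 1) ≤ 2 * (ε / 4) ^ k := by
    intro k
    rcases Nat.eq_zero_or_pos k with rfl | hk
    · norm_num
    · obtain ⟨m, rfl⟩ := Nat.exists_eq_add_of_le' hk
      rw [Nat.add_sub_cancel]
      have h4 : (ε / 4) ^ (m + 1) = (ε / 2) ^ (m + 1) * ((1 / 2) ^ m * (1 / 2)) := by
        rw [← pow_succ, ← mul_pow]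
        congr 1
        ring
      rw [h4, one_div_pow]
      apply le_of_eq
      ring
  have hbound : ∀ (k : Fin n) (x : ℝ), x ∈ Set.Icc 0 ε → |(p k).eval x| ≤ 2 * (ε / 4) ^ (k : ℕ) := by
    intro k x hx
    have hLx : |L.eval x| ≤ 1 := by
      rw [hL]
      simp only [eval_sub, eval_mul, eval_C, eval_X]
      rw [abs_le]
      constructor
      · have : 0 ≤ 2 / ε * x := by have := hx.1; positivity
        linarith
      · have h2 : 2 / ε * x ≤ 2 := by
          rw [div_mul_eq_mul_div, div_le_iff₀ hε]
          linarith [hx.2]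
        linarith
    have hT : |(Chebyshev.T ℝ (k : ℕ)).eval (L.eval x)| ≤ 1 :=
      Chebyshev.abs_eval_T_real_le_one _ hLx
    rw [hp]
    dsimp only
    rw [eval_mul, eval_C, eval_comp, abs_mul, abs_of_pos (by positivity)]
    calc (ε / 2) ^ (k : ℕ) / 2 ^ ((k : ℕ) - 1) * |(Chebyshev.T ℝ (k : ℕ)).eval (L.eval x)|
        ≤ (ε / 2) ^ (k : ℕ) / 2 ^ ((k : ℕ) - 1) * 1 := by gcongr
      _ ≤ 2 * (ε / 4) ^ (k : ℕ) := by rw [mul_one]; exact hnum k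
  -- Vandermonde = det of the polynomial matrix; pull the column bounds out
  rw [Matrix.det_eval_matrixOfPolynomials_eq_det_vandermonde u p hdeg hmonic]
  set c : Fin n → ℝ := fun j => 2 * (ε / 4) ^ (j : ℕ) with hc
  have hcpos : ∀ j, 0 < c j := fun j => by positivity
  have hM : (Matrix.of fun i j : Fin n => (p j).eval (u i))
      = Matrix.of fun i j : Fin n => c j * ((p j).eval (u i) / c j) := by
    ext i j
    simp only [Matrix.of_apply]
    rw [mul_div_cancel₀ _ (hcpos j).ne']
  rw [hM, Matrix.det_mul_row c]
  have hA : |(Matrix.of fun i j : Fin n => (p j).eval (u i) / c j).det| ≤ (Nat.factorial n : ℝ) := by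
    have h := Matrix.det_le (A := Matrix.of fun i j : Fin n => (p j).eval (u i) / c j)
      (abv := AbsoluteValue.abs) (x := (1 : ℝ)) (fun i j => ?_)
    · simpa using h
    · rw [AbsoluteValue.abs_apply, Matrix.of_apply, abs_div, abs_of_pos (hcpos j),
        div_le_one (hcpos j)]
      exact hbound j (u i) (hu i)
  have hprod : ∏ j : Fin n, c j = 2 ^ n * (ε / 4) ^ (n * (n - 1) / 2) := by
    simp only [hc]
    rw [Finset.prod_mul_distrib, Finset.prod_const, Finset.card_univ, Fintype.card_fin,
      Fin.prod_univ_eq_prod_range (fun k => (ε / 4) ^ k) n, Finset.prod_pow_eq_pow_sum,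
      Finset.sum_range_id]
  rw [abs_mul, hprod, abs_of_pos (by positivity)]
  calc 2 ^ n * (ε / 4) ^ (n * (n - 1) / 2) * |(Matrix.of fun i j : Fin n => (p j).eval (u i) / c j).det|
      ≤ 2 ^ n * (ε / 4) ^ (n * (n - 1) / 2) * (Nat.factorial n : ℝ) := by gcongr
    _ = (Nat.factorial n : ℝ) * 2 ^ n * (ε / 4) ^ (n * (n - 1) / 2) := by ring

/-! ### (D) `0 ≤ R_n ≤ n! 4ⁿ (ε/4)^{n(n−1)} ω(γ)ⁿ` -/

section Bounds

variable {α : Type*} [MeasurableSpace α]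

/-- `R_n ≥ 0` ("because the integrand is nonnegative"). [cite: Zudilin2017Det, §2, after display (3)] -/
theorem hankel_det_nonneg (μ : Measure α) [IsFiniteMeasure μ] (z : α → ℝ)
    (hz : AEStronglyMeasurable z μ) {ε : ℝ} (hzb : ∀ x, |z x| ≤ ε)
    (r : ℕ → ℝ) (hr : ∀ m, r m = ∫ x, z x ^ m ∂μ) (n : ℕ) : 0 ≤ (hankel r n).det := by
  have h := factorial_mul_hankel_det_eq_integral μ z hz hzb r hr n
  have hpos : (0 : ℝ) < ((Nat.factorial n : ℕ) : ℝ) := by exact_mod_cast Nat.factorial_pos n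
  have : 0 ≤ ((Nat.factorial n : ℕ) : ℝ) * (hankel r n).det := by
    rw [h]; exact integral_nonneg fun X => sq_nonneg _
  exact (mul_nonneg_iff_of_pos_left hpos).1 this

/-- (D) The smallness of `R_n`: for `0 ≤ z ≤ ε` on a finite measure space,
`R_n ≤ n! · 4ⁿ · (ε/4)^{n(n−1)} · μ(univ)ⁿ` — the effective form of the source's
`R_n < (ε/4)^{n² + o(n²)}`. [cite: Zudilin2017Det, §2 display (5) and the line after it] -/
theorem hankel_det_le (μ : Measure α) [IsFiniteMeasure μ] (z : α → ℝ)
    (hz : AEStronglyMeasurable z μ) {ε : ℝ} (hε : 0 < ε) (hz0 : ∀ x, 0 ≤ z x) (hzε : ∀ x, z x ≤ ε)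
    (r : ℕ → ℝ) (hr : ∀ m, r m = ∫ x, z x ^ m ∂μ) (n : ℕ) :
    (hankel r n).det
      ≤ (Nat.factorial n : ℝ) * 4 ^ n * (ε / 4) ^ (n * (n - 1)) * (μ.real Set.univ) ^ n := by
  have hzb : ∀ x, |z x| ≤ ε := fun x => by rw [abs_of_nonneg (hz0 x)]; exact hzε x
  have h := factorial_mul_hankel_det_eq_integral μ z hz hzb r hr n
  set B : ℝ := (Nat.factorial n : ℝ) * 2 ^ n * (ε / 4) ^ (n * (n - 1) / 2) with hB
  have hVle : ∀ X : Fin n → α,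
      (∏ i : Fin n, ∏ j ∈ Ioi i, (z (X j) - z (X i))) ^ 2 ≤ B ^ 2 := by
    intro X
    have h1 := abs_det_vandermonde_le hε (fun r => z (X r)) (fun i => ⟨hz0 _, hzε _⟩)
    rw [Matrix.det_vandermonde] at h1
    rw [← sq_abs]
    exact pow_le_pow_left₀ (abs_nonneg _) h1 2
  have hle : ∫ X : Fin n → α, (∏ i : Fin n, ∏ j ∈ Ioi i, (z (X j) - z (X i))) ^ 2
        ∂(Measure.pi fun _ => μ)
      ≤ ∫ _X : Fin n → α, B ^ 2 ∂(Measure.pi fun _ => μ) :=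
    integral_mono_of_nonneg (Eventually.of_forall fun X => sq_nonneg _) (integrable_const _)
      (Eventually.of_forall hVle)
  rw [integral_const, smul_eq_mul] at hle
  have hμ : (Measure.pi fun _ : Fin n => μ).real Set.univ = (μ.real Set.univ) ^ n := by
    rw [measureReal_def, Measure.pi_univ, ENNReal.toReal_prod, Finset.prod_const, Finset.card_univ,
      Fintype.card_fin, measureReal_def]
  rw [hμ] at hle
  have hfac : (0 : ℝ) < (Nat.factorial n : ℝ) := by exact_mod_cast Nat.factorial_pos n
  have h2 : n * (n - 1) / 2 * 2 = n * (n - 1) :=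
    Nat.div_mul_cancel (Nat.even_mul_pred_self n).two_dvd
  have hB2 : B ^ 2 = (Nat.factorial n : ℝ) ^ 2 * 4 ^ n * (ε / 4) ^ (n * (n - 1)) := by
    have h4 : ((2 : ℝ) ^ n) ^ 2 = 4 ^ n := by
      rw [← pow_mul, mul_comm, pow_mul]; norm_num
    have h5 : ((ε / 4) ^ (n * (n - 1) / 2)) ^ 2 = (ε / 4) ^ (n * (n - 1)) := by
      rw [← pow_mul, h2]
    rw [hB, mul_pow, mul_pow, h4, h5]
  have key : (Nat.factorial n : ℝ) * (hankel r n).det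
      ≤ (Nat.factorial n : ℝ) *
        ((Nat.factorial n : ℝ) * 4 ^ n * (ε / 4) ^ (n * (n - 1)) * (μ.real Set.univ) ^ n) := by
    have : ((Nat.factorial n : ℕ) : ℝ) * (hankel r n).det ≤ (μ.real Set.univ) ^ n * B ^ 2 := by
      rw [h]; exact hle
    rw [hB2] at this
    calc _ ≤ _ := this
      _ = _ := by ring
  exact le_of_mul_le_mul_left key hfac

end Bounds

/-! ### (E) The criterion -/

/-- `∑_{j<n} (n − 1 + j) = n(n−1) + n(n−1)/2` (the exponent in `δ_{n−1}⋯δ_{2n−2} ≤ C₂ⁿ Δ^{3n(n−1)/2}`;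
private helper). [folklore] -/
private theorem sum_shift_exponent (n : ℕ) :
    ∑ j : Fin n, (n - 1 + (j : ℕ)) = n * (n - 1) + n * (n - 1) / 2 := by
  rw [Fin.sum_univ_eq_sum_range (fun j => n - 1 + j) n, Finset.sum_add_distrib, Finset.sum_const,
    Finset.card_range, smul_eq_mul, Finset.sum_range_id]

/-- **Zudilin's determinantal criterion** [Zudilin2017Det, Proposition 2], proved. Data: `r_m = a_m ξ − b_m`
with (b) `δ_m a_m, δ_m b_m ∈ ℤ`, (e) `δ_m ∣ δ_{m+1}`, (c) `δ_m ≤ C₂ Δᵐ` (`Δ > 0`), (d) `r_m = ∫ zᵐ dμ` for a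
finite measure `μ` and a function `0 ≤ z ≤ ε` (`ε > 0`), and (d′) the Hankel determinants
`R_n = det (r_{j+ℓ})_{j,ℓ<n}` are non-zero for infinitely many `n` (automatic in the printed setting, where
`z` is continuous and non-constant on a domain — see the module docstring; hypothesis (a) of the source is
then not needed). Conclusion: if `ε Δ^{3/2} / 4 < 1` then `ξ` is irrational.
Proof = the printed one: `(∏_{j<n} δ_{n−1+j}) qⁿ R_n` is a non-zero integer for such `n` when `ξ = p/q`
(`exists_int_eq_scaled_hankel_det`), while by Heine's identity and the Chebyshev bound
(`hankel_det_le`) it is at most `(4 C₂ q μ(univ))ⁿ · n! · (εΔ^{3/2}/4)^{n(n−1)} < 1` for large `n`.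
[cite: Zudilin2017Det, Proposition 2 and §2 "Proof of Proposition 2"] -/
theorem irrational_of_hankel (ξ : ℝ) (r a b : ℕ → ℝ) (hr : ∀ m, r m = a m * ξ - b m)
    (δ : ℕ → ℕ) (hδ : ∀ m, 0 < δ m) (hchain : ∀ m, δ m ∣ δ (m + 1))
    (A B : ℕ → ℤ) (ha : ∀ m, (δ m : ℝ) * a m = A m) (hb : ∀ m, (δ m : ℝ) * b m = B m)
    {C₂ Δ : ℝ} (hΔ : 0 < Δ) (hδle : ∀ m, (δ m : ℝ) ≤ C₂ * Δ ^ m)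
    {α : Type*} [MeasurableSpace α] (μ : Measure α) [IsFiniteMeasure μ] (z : α → ℝ)
    (hz : AEStronglyMeasurable z μ) {ε : ℝ} (hε : 0 < ε) (hz0 : ∀ x, 0 ≤ z x) (hzε : ∀ x, z x ≤ ε)
    (hrz : ∀ m, r m = ∫ x, z x ^ m ∂μ)
    (hne : ∃ᶠ n in atTop, (hankel r n).det ≠ 0)
    (hcrit : ε * Δ ^ ((3 : ℝ) / 2) / 4 < 1) :
    Irrational ξ := by
  -- `θ = ε Δ √Δ / 4 = ε Δ^{3/2} / 4 < 1`
  set θ : ℝ := ε * Δ * Real.sqrt Δ / 4 with hθdef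
  have hΔ32 : Δ ^ ((3 : ℝ) / 2) = Δ * Real.sqrt Δ := by
    rw [show (3 : ℝ) / 2 = 1 + 1 / 2 by norm_num, Real.rpow_add hΔ, Real.rpow_one, Real.sqrt_eq_rpow]
  have hθ1 : θ < 1 := by rw [hθdef, mul_assoc ε, ← hΔ32]; exact hcrit
  have hθ0 : 0 ≤ θ := by positivity
  have hC₂ : 0 < C₂ := by
    have h0 := hδle 0
    have h1 : (1 : ℝ) ≤ δ 0 := by exact_mod_cast hδ 0
    simp only [pow_zero, mul_one] at h0
    linarith
  set m : ℝ := μ.real Set.univ with hm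
  have hm0 : 0 ≤ m := measureReal_nonneg
  rintro ⟨Q, hQ⟩
  set p : ℤ := Q.num with hp
  set q : ℕ := Q.den with hq
  have hq0 : 0 < q := Q.den_pos
  have hξ : ξ = p / q := by rw [← hQ, hp, hq]; exact Rat.cast_def Q
  -- `G · n · θ^{n−1} → 0`
  set G : ℝ := 4 * C₂ * q * m with hG
  have hG0 : 0 ≤ G := by positivity
  have htend : Tendsto (fun n : ℕ => G * ((n : ℝ) * θ ^ (n - 1))) atTop (𝓝 0) := by
    have h1 : Tendsto (fun n : ℕ => ((n : ℝ) + 1) * θ ^ n) atTop (𝓝 0) := by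
      have ha' := tendsto_self_mul_const_pow_of_lt_one hθ0 hθ1
      have hb' := tendsto_pow_atTop_nhds_zero_of_lt_one hθ0 hθ1
      simpa [add_mul] using ha'.add hb'
    have h2 : Tendsto (fun n : ℕ => (n : ℝ) * θ ^ (n - 1)) atTop (𝓝 0) := by
      rw [← tendsto_add_atTop_iff_nat 1]
      simpa using h1
    simpa using h2.const_mul G
  have hev : ∀ᶠ n : ℕ in atTop, G * ((n : ℝ) * θ ^ (n - 1)) < 1 / 2 :=
    (tendsto_order.1 htend).2 _ (by norm_num)
  obtain ⟨n, hdet, hsmall, hn1⟩ := (hne.and_eventually (hev.and (eventually_ge_atTop 1))).exists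
  -- the non-zero integer
  obtain ⟨K, hK⟩ := exists_int_eq_scaled_hankel_det r a b ξ hr δ hδ hchain A B ha hb p q hq0 hξ n
  have hprodpos : 0 < ∏ j : Fin n, ((δ (n - 1 + j) : ℝ) * q) :=
    Finset.prod_pos fun j _ => by
      have : (0 : ℝ) < δ (n - 1 + j) := by exact_mod_cast hδ _
      positivity
  have hKne : K ≠ 0 := by
    intro h0
    rw [h0, Int.cast_zero] at hK
    exact hdet ((mul_eq_zero.1 hK).resolve_left hprodpos.ne')
  have hK1 : (1 : ℝ) ≤ |(K : ℝ)| := by exact_mod_cast Int.one_le_abs hKne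
  -- the upper bound
  have hzb : ∀ x, |z x| ≤ ε := fun x => by rw [abs_of_nonneg (hz0 x)]; exact hzε x
  have hHle := hankel_det_le μ z hz hε hz0 hzε r hrz n
  have hH0 := hankel_det_nonneg μ z hz hzb r hrz n
  have h2 : n * (n - 1) / 2 * 2 = n * (n - 1) :=
    Nat.div_mul_cancel (Nat.even_mul_pred_self n).two_dvd
  have hsqrt : Real.sqrt Δ ^ (n * (n - 1)) = Δ ^ (n * (n - 1) / 2) := by
    conv_lhs => rw [← h2, pow_mul', Real.sq_sqrt hΔ.le]
  have hprodle : ∏ j : Fin n, ((δ (n - 1 + j) : ℝ) * q)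
      ≤ (C₂ * q) ^ n * (Δ ^ (n * (n - 1)) * Real.sqrt Δ ^ (n * (n - 1))) := by
    calc ∏ j : Fin n, ((δ (n - 1 + j) : ℝ) * q)
        ≤ ∏ j : Fin n, ((C₂ * q) * Δ ^ (n - 1 + (j : ℕ))) :=
          Finset.prod_le_prod (fun j _ => by positivity) (fun j _ => by
            calc ((δ (n - 1 + j) : ℝ) * q) ≤ (C₂ * Δ ^ (n - 1 + (j : ℕ))) * q := by
                  gcongr; exact hδle _
              _ = (C₂ * q) * Δ ^ (n - 1 + (j : ℕ)) := by ring)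
      _ = (C₂ * q) ^ n * Δ ^ (n * (n - 1) + n * (n - 1) / 2) := by
          rw [Finset.prod_mul_distrib, Finset.prod_const, Finset.card_univ, Fintype.card_fin,
            Finset.prod_pow_eq_pow_sum, sum_shift_exponent]
      _ = (C₂ * q) ^ n * (Δ ^ (n * (n - 1)) * Real.sqrt Δ ^ (n * (n - 1))) := by
          rw [hsqrt, pow_add]
  have hKle : |(K : ℝ)| ≤ G ^ n * (Nat.factorial n : ℝ) * θ ^ (n * (n - 1)) := by
    rw [← hK, abs_of_nonneg (mul_nonneg hprodpos.le hH0)]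
    calc (∏ j : Fin n, ((δ (n - 1 + j) : ℝ) * q)) * (hankel r n).det
        ≤ ((C₂ * q) ^ n * (Δ ^ (n * (n - 1)) * Real.sqrt Δ ^ (n * (n - 1)))) *
            ((Nat.factorial n : ℝ) * 4 ^ n * (ε / 4) ^ (n * (n - 1)) * m ^ n) :=
          mul_le_mul hprodle hHle hH0 (by positivity)
      _ = G ^ n * (Nat.factorial n : ℝ) * θ ^ (n * (n - 1)) := by
          rw [hG, hθdef]; ring
  -- `Gⁿ n! θ^{n(n−1)} ≤ (G n θ^{n−1})ⁿ ≤ (1/2)ⁿ < 1`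
  have hfin : G ^ n * (Nat.factorial n : ℝ) * θ ^ (n * (n - 1)) < 1 := by
    have hnf : (Nat.factorial n : ℝ) ≤ (n : ℝ) ^ n := by exact_mod_cast Nat.factorial_le_pow n
    calc G ^ n * (Nat.factorial n : ℝ) * θ ^ (n * (n - 1))
        ≤ G ^ n * (n : ℝ) ^ n * θ ^ (n * (n - 1)) := by gcongr
      _ = (G * ((n : ℝ) * θ ^ (n - 1))) ^ n := by
          have hθpow : θ ^ (n * (n - 1)) = (θ ^ (n - 1)) ^ n := by rw [← pow_mul, mul_comm]
          rw [hθpow]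
          ring
      _ ≤ (1 / 2 : ℝ) ^ n := pow_le_pow_left₀ (by positivity) hsmall.le n
      _ < 1 := pow_lt_one₀ (by norm_num) (by norm_num) (by omega)
  linarith [hK1, hKle, hfin]

/-! ### (F) `R_n > 0` in the printed setting, and Proposition 2 with hypothesis (d) as printed -/

section Positivity

variable {α : Type*} [MeasurableSpace α] [TopologicalSpace α] [OpensMeasurableSpace α]

omit [TopologicalSpace α] [OpensMeasurableSpace α] in
/-- Integrability of `V(z∘X)²` on the finite product (bounded measurable function; private helper). [folklore] -/
private theorem integrable_vandermonde_sq (μ : Measure α) [IsFiniteMeasure μ] (z : α → ℝ)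
    (hzm : Measurable z) {ε : ℝ} (hzb : ∀ x, |z x| ≤ ε) (n : ℕ) :
    Integrable (fun X : Fin n → α => (∏ i : Fin n, ∏ j ∈ Ioi i, (z (X j) - z (X i))) ^ 2)
      (Measure.pi fun _ => μ) := by
  have hmeas : Measurable
      (fun X : Fin n → α => (∏ i : Fin n, ∏ j ∈ Ioi i, (z (X j) - z (X i))) ^ 2) := by
    refine Measurable.pow_const ?_ 2
    refine Finset.measurable_prod _ fun i _ => Finset.measurable_prod _ fun j _ => ?_
    exact (hzm.comp (measurable_pi_apply j)).sub (hzm.comp (measurable_pi_apply i))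
  set M : ℝ := max 1 (2 * ε) with hM
  have hM1 : 1 ≤ M := le_max_left _ _
  refine Integrable.mono' (integrable_const (((M ^ n) ^ n) ^ 2)) hmeas.aestronglyMeasurable
    (Eventually.of_forall fun X => ?_)
  rw [Real.norm_eq_abs, abs_pow]
  refine pow_le_pow_left₀ (abs_nonneg _) ?_ 2
  rw [Finset.abs_prod]
  calc ∏ i : Fin n, |∏ j ∈ Ioi i, (z (X j) - z (X i))|
      ≤ ∏ _i : Fin n, M ^ n := Finset.prod_le_prod (fun i _ => abs_nonneg _) (fun i _ => by
          rw [Finset.abs_prod]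
          calc ∏ j ∈ Ioi i, |z (X j) - z (X i)|
              ≤ ∏ _j ∈ Ioi i, M := Finset.prod_le_prod (fun _ _ => abs_nonneg _) (fun j _ => by
                  calc |z (X j) - z (X i)| ≤ |z (X j)| + |z (X i)| := abs_sub _ _
                    _ ≤ ε + ε := add_le_add (hzb _) (hzb _)
                    _ = 2 * ε := by ring
                    _ ≤ M := le_max_right _ _)
            _ = M ^ (Ioi i).card := Finset.prod_const M
            _ ≤ M ^ n := pow_le_pow_right₀ hM1 (by simpa using Finset.card_le_univ (Ioi i)))
    _ = (M ^ n) ^ n := by simp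

/-- (F) **Positivity of the Hankel determinants** in the printed setting: if `z` is continuous with infinitely
many values (e.g. non-constant on a preconnected space, `irrational_of_hankel_of_preconnected`) and the finite measure `μ`
charges every non-empty open set, then `R_n > 0` for every `n` — the source's "Note that `R_n > 0`, because
the integrand is nonnegative" made precise: on a product of `n` open sets where `z` takes pairwise separated
values the Heine integrand `∏_{i<j}(z(x_j) − z(x_i))²` is non-zero. [cite: Zudilin2017Det, §2, line after
display (3)] -/
theorem hankel_det_pos (μ : Measure α) [IsFiniteMeasure μ] [μ.IsOpenPosMeasure] (z : α → ℝ)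
    (hz : Continuous z) {ε : ℝ} (hzb : ∀ x, |z x| ≤ ε) (hinf : (Set.range z).Infinite)
    (r : ℕ → ℝ) (hr : ∀ m, r m = ∫ x, z x ^ m ∂μ) (n : ℕ) : 0 < (hankel r n).det := by
  have hzm : Measurable z := hz.measurable
  have h := factorial_mul_hankel_det_eq_integral μ z hzm.aestronglyMeasurable hzb r hr n
  have hfac : (0 : ℝ) < ((Nat.factorial n : ℕ) : ℝ) := by exact_mod_cast Nat.factorial_pos n
  suffices hpos : 0 < ∫ X : Fin n → α, (∏ i : Fin n, ∏ j ∈ Ioi i, (z (X j) - z (X i))) ^ 2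
      ∂(Measure.pi fun _ => μ) by
    rw [← h] at hpos
    exact (mul_pos_iff_of_pos_left hfac).1 hpos
  rw [integral_pos_iff_support_of_nonneg (fun X => sq_nonneg _)
    (integrable_vandermonde_sq μ z hzm hzb n)]
  -- `n` distinct values `e i` of `z`, attained at points `x i`
  set e := hinf.natEmbedding (Set.range z) with he
  have hv : ∀ i : Fin n, ∃ x : α, z x = (e i : ℝ) := fun i => (e i).2
  choose x hx using hv
  have hinj : ∀ i j : Fin n, i ≠ j → ((e i : Set.range z) : ℝ) ≠ (e j : Set.range z) := by
    intro i j hij heq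
    apply hij
    have h1 : e i = e j := Subtype.ext heq
    exact Fin.ext (e.injective h1)
  -- a separation `d > 0` of the values
  obtain ⟨d, hd0, hsep⟩ : ∃ d : ℝ, 0 < d ∧
      ∀ i j : Fin n, i ≠ j → d ≤ |((e i : Set.range z) : ℝ) - (e j : Set.range z)| := by
    by_cases hne : (Finset.univ.filter fun p : Fin n × Fin n => p.1 ≠ p.2).Nonempty
    · obtain ⟨p₀, hp₀, hmin⟩ := Finset.exists_min_image _
        (fun p : Fin n × Fin n => |((e p.1 : Set.range z) : ℝ) - (e p.2 : Set.range z)|) hne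
      have hp₀' : p₀.1 ≠ p₀.2 := by simpa using hp₀
      exact ⟨_, abs_pos.2 (sub_ne_zero.2 (hinj _ _ hp₀')), fun i j hij => hmin (i, j) (by simpa using hij)⟩
    · exact ⟨1, one_pos, fun i j hij => absurd ⟨(i, j), by simpa using hij⟩ hne⟩
  -- open neighbourhoods `U i = z⁻¹(B(e i, d/2))`, each of positive measure
  set U : Fin n → Set α := fun i => z ⁻¹' Metric.ball ((e i : Set.range z) : ℝ) (d / 2) with hU
  have hUo : ∀ i, IsOpen (U i) := fun i => Metric.isOpen_ball.preimage hz
  have hUne : ∀ i, (U i).Nonempty := fun i =>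
    ⟨x i, by simp only [hU, Set.mem_preimage, hx i]; exact Metric.mem_ball_self (by positivity)⟩
  have hUpos : ∀ i, 0 < μ (U i) := fun i => (hUo i).measure_pos μ (hUne i)
  -- on the box `∏ U i` the Heine integrand does not vanish
  have hbox : Set.pi Set.univ U ⊆
      Function.support (fun X : Fin n → α => (∏ i : Fin n, ∏ j ∈ Ioi i, (z (X j) - z (X i))) ^ 2) := by
    intro X hX
    rw [Function.mem_support]
    apply pow_ne_zero
    rw [Finset.prod_ne_zero_iff]
    intro i _
    rw [Finset.prod_ne_zero_iff]
    intro j hj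
    have hij : i ≠ j := (Finset.mem_Ioi.1 hj).ne
    have hi := hX i (Set.mem_univ _)
    have hj' := hX j (Set.mem_univ _)
    simp only [hU, Set.mem_preimage, Metric.mem_ball, Real.dist_eq] at hi hj'
    intro heq
    have hzz : z (X j) = z (X i) := sub_eq_zero.1 heq
    have hlt : |((e i : Set.range z) : ℝ) - (e j : Set.range z)| < d := by
      calc |((e i : Set.range z) : ℝ) - (e j : Set.range z)|
          = |(((e i : Set.range z) : ℝ) - z (X i)) + (z (X j) - (e j : Set.range z))| := by
            rw [hzz]; congr 1; ring
        _ ≤ |((e i : Set.range z) : ℝ) - z (X i)| + |z (X j) - (e j : Set.range z)| := abs_add_le _ _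
        _ < d / 2 + d / 2 := add_lt_add (by rw [abs_sub_comm]; exact hi) hj'
        _ = d := by ring
    linarith [hsep i j hij]
  calc (0 : ENNReal) < Measure.pi (fun _ => μ) (Set.pi Set.univ U) := by
        rw [Measure.pi_pi, pos_iff_ne_zero, Finset.prod_ne_zero_iff]
        exact fun i _ => (hUpos i).ne'
    _ ≤ Measure.pi (fun _ => μ) (Function.support
          (fun X : Fin n → α => (∏ i : Fin n, ∏ j ∈ Ioi i, (z (X j) - z (X i))) ^ 2)) :=
        measure_mono hbox

omit [MeasurableSpace α] [OpensMeasurableSpace α] in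
/-- A continuous function taking two distinct values on a preconnected space has infinitely many values
(intermediate value theorem) — the printed "non-constant continuous `z` on a domain `γ`" (private helper).
[folklore] -/
private theorem infinite_range_of_lt [PreconnectedSpace α] (z : α → ℝ) (hz : Continuous z) {a b : α}
    (h : z a < z b) : (Set.range z).Infinite :=
  (Set.Icc_infinite h).mono (intermediate_value_univ a b hz)

/-- **Zudilin's Proposition 2 with hypothesis (d) as printed** (topological form): as `irrational_of_hankel`,
with (d′) replaced by: `μ` is a finite measure charging non-empty open sets, `z` is continuous with infinitely
many values (non-constant on a preconnected space suffices: `irrational_of_hankel_of_preconnected`); then `R_n > 0` for all `n`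
(`hankel_det_pos`) and `ε Δ^{3/2} / 4 < 1 ⇒ ξ ∉ ℚ`. [cite: Zudilin2017Det, Proposition 2] -/
theorem irrational_of_hankel_of_continuous (ξ : ℝ) (r a b : ℕ → ℝ) (hr : ∀ m, r m = a m * ξ - b m)
    (δ : ℕ → ℕ) (hδ : ∀ m, 0 < δ m) (hchain : ∀ m, δ m ∣ δ (m + 1))
    (A B : ℕ → ℤ) (ha : ∀ m, (δ m : ℝ) * a m = A m) (hb : ∀ m, (δ m : ℝ) * b m = B m)
    {C₂ Δ : ℝ} (hΔ : 0 < Δ) (hδle : ∀ m, (δ m : ℝ) ≤ C₂ * Δ ^ m)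
    (μ : Measure α) [IsFiniteMeasure μ] [μ.IsOpenPosMeasure] (z : α → ℝ) (hz : Continuous z)
    {ε : ℝ} (hε : 0 < ε) (hz0 : ∀ x, 0 ≤ z x) (hzε : ∀ x, z x ≤ ε) (hinf : (Set.range z).Infinite)
    (hrz : ∀ m, r m = ∫ x, z x ^ m ∂μ)
    (hcrit : ε * Δ ^ ((3 : ℝ) / 2) / 4 < 1) :
    Irrational ξ := by
  have hzb : ∀ x, |z x| ≤ ε := fun x => by rw [abs_of_nonneg (hz0 x)]; exact hzε x
  refine irrational_of_hankel ξ r a b hr δ hδ hchain A B ha hb hΔ hδle μ z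
    hz.measurable.aestronglyMeasurable hε hz0 hzε hrz ?_ hcrit
  exact Eventually.frequently (Eventually.of_forall fun n =>
    (hankel_det_pos μ z hz hzb hinf r hrz n).ne')

/-- **Zudilin's Proposition 2, hypothesis (d) verbatim for a connected domain**: `γ = α` a preconnected space
(a domain), `μ` a finite measure positive on non-empty open sets (a positive density), `z` continuous,
`0 ≤ z ≤ ε`, and NON-CONSTANT (`z a < z b` for some `a, b`); with (b), (c), (e) and `ε Δ^{3/2} / 4 < 1`, `ξ` is
irrational. [cite: Zudilin2017Det, Proposition 2] -/
theorem irrational_of_hankel_of_preconnected [PreconnectedSpace α] (ξ : ℝ) (r a b : ℕ → ℝ)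
    (hr : ∀ m, r m = a m * ξ - b m)
    (δ : ℕ → ℕ) (hδ : ∀ m, 0 < δ m) (hchain : ∀ m, δ m ∣ δ (m + 1))
    (A B : ℕ → ℤ) (ha : ∀ m, (δ m : ℝ) * a m = A m) (hb : ∀ m, (δ m : ℝ) * b m = B m)
    {C₂ Δ : ℝ} (hΔ : 0 < Δ) (hδle : ∀ m, (δ m : ℝ) ≤ C₂ * Δ ^ m)
    (μ : Measure α) [IsFiniteMeasure μ] [μ.IsOpenPosMeasure] (z : α → ℝ) (hz : Continuous z)
    {ε : ℝ} (hε : 0 < ε) (hz0 : ∀ x, 0 ≤ z x) (hzε : ∀ x, z x ≤ ε) {a₀ b₀ : α} (hnc : z a₀ < z b₀)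
    (hrz : ∀ m, r m = ∫ x, z x ^ m ∂μ)
    (hcrit : ε * Δ ^ ((3 : ℝ) / 2) / 4 < 1) :
    Irrational ξ :=
  irrational_of_hankel_of_continuous ξ r a b hr δ hδ hchain A B ha hb hΔ hδle μ z hz hε hz0 hzε
    (infinite_range_of_lt z hz hnc) hrz hcrit

end Positivity

end Literature.NumberTheory.Irrationality.Zudilin2017
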